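import Literature.NumberTheory.LFunctions.MertensElementary
import Mathlib.NumberTheory.PrimeCounting
import Mathlib.Data.Nat.Squarefree
import HarnessLib

/-!
# Moments of the restricted squarefree divisor function

For `y ≥ 2` let `τ♭_y(m) = #{d ≤ y : d squarefree, d ∣ m}`.  We prove the elementary moment
bound (Ruzsa; used by Bourgain 1989 and Green–Tao 2006 in the restriction theory of the primes
/ the Selberg sieve, [GreenTao2006Restriction, §4: "standard moment estimates for the restricted
divisor function `d_{|B|}`, see [Bourgain], [Ruzsa]"])

  `∑_{1 ≤ m ≤ X} τ♭_y(m)^r ≤ X · exp((2^r - 1)(log log y + 4))`   (`sum_pow_card_sqfreeDivisors_le`),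

i.e. `≪_r X (log y)^{2^r - 1}`, uniformly in `X ≥ 0`.  Proof: `τ♭_y(m) ≤ 2^{ω_y(m)}` with
`ω_y(m) = #{p ≤ y : p ∣ m}` (a squarefree `d` is determined by its set of prime factors), so
`τ♭_y(m)^r ≤ (1 + (2^r-1))^{ω_y(m)} = ∑_{U ⊆ {p ≤ y : p ∣ m}} (2^r-1)^{|U|}`; summing over
`m ≤ X` and using `#{m ≤ X : ∏U ∣ m} ≤ X/∏U` gives `≤ X ∏_{p ≤ y} (1 + (2^r-1)/p)`, and
`∏_{p ≤ y}(1 + a/p) ≤ exp(a ∑_{p ≤ y} 1/p) ≤ exp(a (log log y + 4))` by the tree's Mertens bound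
`Literature.NumberTheory.LFunctions.MertensBound.sum_inv_prime_le`.  Everything is PROVED.

## References

* I. Z. Ruzsa, *On an additive property of squares and primes*, Acta Arith. 49 (1988) 281–289.
* J. Bourgain, *On Λ(p)-subsets of squares*, Israel J. Math. 67 (1989) 291–311, §4.
* [GreenTao2006Restriction] B. Green, T. Tao, JTNB 18 (2006), §4 (proof of Prop. 4.1).
-/

open Finset Real

namespace Literature.NumberTheory.Sieve

/-- A squarefree `d ≤ y` dividing `m ≠ 0` is determined by its set of prime factors, which is a
subset of `{p ≤ y : p ∣ m}`; hence `τ♭_y(m) ≤ 2^{ω_y(m)}` (all `m`, including `m = 0`). [folklore] -/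
theorem card_sqfreeDivisors_le_two_pow (y m : ℕ) :
    ((Icc 1 y).filter (fun d => Squarefree d ∧ d ∣ m)).card ≤
      2 ^ ((Nat.primesLE y).filter (fun p => p ∣ m)).card := by
  classical
  rw [← Finset.card_powerset]
  refine Finset.card_le_card_of_injOn (fun d => d.primeFactors) ?_ ?_
  · intro d hd
    rw [Finset.mem_coe, Finset.mem_filter, Finset.mem_Icc] at hd
    rw [Finset.mem_coe, Finset.mem_powerset]
    intro p hp
    have hp' := Nat.mem_primeFactors.1 hp
    rw [Finset.mem_filter, Nat.mem_primesLE]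
    exact ⟨⟨(Nat.le_of_dvd (by omega) hp'.2.1).trans hd.1.2, hp'.1⟩, hp'.2.1.trans hd.2.2⟩
  · intro d hd d' hd' h
    rw [Finset.mem_coe, Finset.mem_filter] at hd hd'
    simp only at h
    rw [← Nat.prod_primeFactors_of_squarefree hd.2.1, ← Nat.prod_primeFactors_of_squarefree hd'.2.1,
      h]

/-- `τ♭_y(m)^r ≤ ∑_{U ⊆ {p ≤ y}, ∏U ∣ m} (2^r - 1)^{|U|}`. [folklore] -/
theorem pow_card_sqfreeDivisors_le_sum (y m : ℕ) (r : ℕ) :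
    ((((Icc 1 y).filter (fun d => Squarefree d ∧ d ∣ m)).card : ℝ)) ^ r ≤
      ∑ U ∈ (Nat.primesLE y).powerset,
        if (∏ p ∈ U, p) ∣ m then ((2 : ℝ) ^ r - 1) ^ U.card else 0 := by
  classical
  set P := (Nat.primesLE y).filter (fun p => p ∣ m) with hP
  have h1 : ((((Icc 1 y).filter (fun d => Squarefree d ∧ d ∣ m)).card : ℝ)) ^ r ≤
      ((2 : ℝ) ^ P.card) ^ r := by
    gcongr
    exact_mod_cast card_sqfreeDivisors_le_two_pow y m
  refine h1.trans ?_
  rw [← pow_mul, mul_comm, pow_mul]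
  -- binomial expansion over subsets of `P`
  have h2 : ((2 : ℝ) ^ r) ^ P.card = ∑ U ∈ P.powerset, ((2 : ℝ) ^ r - 1) ^ U.card := by
    have := Finset.sum_pow_mul_eq_add_pow ((2 : ℝ) ^ r - 1) 1 P
    simp only [one_pow, mul_one, sub_add_cancel] at this
    exact this.symm
  rw [h2]
  -- compare with the sum over subsets of all primes `≤ y`
  rw [← Finset.sum_filter]
  refine Finset.sum_le_sum_of_subset_of_nonneg ?_ fun U _ _ => by
    refine pow_nonneg ?_ _
    have : (1 : ℝ) ≤ 2 ^ r := one_le_pow₀ (by norm_num)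
    linarith
  intro U hU
  rw [Finset.mem_powerset] at hU
  rw [Finset.mem_filter, Finset.mem_powerset]
  refine ⟨hU.trans (Finset.filter_subset _ _), ?_⟩
  refine Finset.prod_primes_dvd m (fun p hp => ?_) (fun p hp => ?_)
  · exact (Nat.prime_of_mem_primesLE (Finset.mem_filter.1 (hU hp)).1).prime
  · exact (Finset.mem_filter.1 (hU hp)).2

/-- `∏_{p ≤ y} (1 + a/p) ≤ exp(a (log log y + 4))` for `a ≥ 0`, `y ≥ 2` (Mertens).
[cite: HardyWright2008, Thm 427] -/
theorem prod_one_add_div_le_exp {a : ℝ} (ha : 0 ≤ a) {y : ℕ} (hy : 2 ≤ y) :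
    ∏ p ∈ Nat.primesLE y, (1 + a / p) ≤ Real.exp (a * (Real.log (Real.log y) + 4)) := by
  have h1 : ∏ p ∈ Nat.primesLE y, (1 + a / p) ≤ ∏ p ∈ Nat.primesLE y, Real.exp (a / p) := by
    refine Finset.prod_le_prod (fun p _ => by positivity) fun p _ => ?_
    linarith [Real.add_one_le_exp (a / p)]
  refine h1.trans ?_
  rw [← Real.exp_sum, Real.exp_le_exp]
  have h2 : ∑ p ∈ Nat.primesLE y, a / (p : ℝ) = a * ∑ p ∈ Nat.primesLE y, (1 : ℝ) / p := by
    rw [Finset.mul_sum]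
    refine Finset.sum_congr rfl fun p _ => ?_
    ring
  rw [h2]
  exact mul_le_mul_of_nonneg_left
    (Literature.NumberTheory.LFunctions.MertensBound.sum_inv_prime_le y hy) ha

/-- **Moments of the restricted squarefree divisor function** (Ruzsa): for `y ≥ 2`, `r ≥ 0` and
every `X`,
`∑_{1 ≤ m ≤ X} #{d ≤ y : d squarefree, d ∣ m}^r ≤ X · exp((2^r − 1)(log log y + 4))`.
[cite: GreenTao2006Restriction, §4 (moment estimate for the restricted divisor function)] -/
theorem sum_pow_card_sqfreeDivisors_le (r : ℕ) {y : ℕ} (hy : 2 ≤ y) (X : ℕ) :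
    ∑ m ∈ Icc 1 X, ((((Icc 1 y).filter (fun d => Squarefree d ∧ d ∣ m)).card : ℝ)) ^ r ≤
      X * Real.exp (((2 : ℝ) ^ r - 1) * (Real.log (Real.log y) + 4)) := by
  classical
  set a : ℝ := (2 : ℝ) ^ r - 1 with ha
  have ha0 : 0 ≤ a := by
    have : (1 : ℝ) ≤ 2 ^ r := one_le_pow₀ (by norm_num)
    rw [ha]; linarith
  -- pointwise expansion and interchange of summations
  calc ∑ m ∈ Icc 1 X, ((((Icc 1 y).filter (fun d => Squarefree d ∧ d ∣ m)).card : ℝ)) ^ r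
      ≤ ∑ m ∈ Icc 1 X, ∑ U ∈ (Nat.primesLE y).powerset,
          if (∏ p ∈ U, p) ∣ m then a ^ U.card else 0 := by
        exact Finset.sum_le_sum fun m _ => pow_card_sqfreeDivisors_le_sum y m r
    _ = ∑ U ∈ (Nat.primesLE y).powerset, a ^ U.card *
          (((Icc 1 X).filter (fun m => (∏ p ∈ U, p) ∣ m)).card : ℝ) := by
        rw [Finset.sum_comm]
        refine Finset.sum_congr rfl fun U _ => ?_
        rw [← Finset.sum_filter, Finset.sum_const, nsmul_eq_mul, mul_comm]
    _ ≤ ∑ U ∈ (Nat.primesLE y).powerset, a ^ U.card * ((X : ℝ) / ∏ p ∈ U, (p : ℝ)) := by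
        refine Finset.sum_le_sum fun U hU => mul_le_mul_of_nonneg_left ?_ (pow_nonneg ha0 _)
        rw [Finset.mem_powerset] at hU
        have hpos : (0 : ℝ) < ∏ p ∈ U, (p : ℝ) :=
          Finset.prod_pos fun p hp => by exact_mod_cast (Nat.prime_of_mem_primesLE (hU hp)).pos
        have hcard : ((Icc 1 X).filter (fun m => (∏ p ∈ U, p) ∣ m)).card = X / ∏ p ∈ U, p := by
          rw [show Icc 1 X = Ioc 0 X from rfl]
          exact Nat.Ioc_filter_dvd_card_eq_div X _
        rw [hcard, le_div_iff₀ hpos, ← Nat.cast_prod]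
        exact_mod_cast Nat.div_mul_le_self X _
    _ = X * ∏ p ∈ Nat.primesLE y, (1 + a / p) := by
        have h : ∀ p ∈ Nat.primesLE y, (1 + a / (p : ℝ)) = a / p + 1 := fun p _ => add_comm _ _
        rw [Finset.prod_congr rfl h, Finset.prod_add, Finset.mul_sum]
        refine Finset.sum_congr rfl fun U _ => ?_
        rw [Finset.prod_const_one, mul_one, Finset.prod_div_distrib, Finset.prod_const]
        ring
    _ ≤ X * Real.exp (a * (Real.log (Real.log y) + 4)) :=
        mul_le_mul_of_nonneg_left (prod_one_add_div_le_exp ha0 hy) (Nat.cast_nonneg X)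

end Literature.NumberTheory.Sieve
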